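import Summits.CriticalPhenomena.PercolationContinuityZ3.Theorems.PercNearOneGluingNoHeavyLowerTailKNGoodGCThreeRow
import Summits.CriticalPhenomena.PercolationContinuityZ3.Theorems.PercNearOneGluingNoHeavyLowerTailTieLocusCorner
import HarnessLib

/-!
# GC₃ with ADJACENT children, and: every separated quadruple with three relays and at most three vertices on the
# observer's side is Kozma–Nitzan-good (`NoHeavyLowerTail` cell, stmt-CriticalPhenomena-4575; prover `prim-hp-2`, gen 14)

Support file (`--supports stmt-CriticalPhenomena-4575`).  No definitions, no named facts, no sorries.
Memo: `run/shared/lean/prim/prim-hp-2/MEMO-gen14-goodness-designated-forms.md` §6.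

`KNGoodGC3.gc_threeRelays` (gen 12, p217910) proves the three-relay gluing inequality for two PENDANT stars `x, y` (no pair
between them): with `j` the loneliest relay of `u = C + x + y`, the goodness functional of the glued observer `u[xy ↦ 1]` at the
witness `j` is non-negative.  Its proof uses the loneliness of `j` only through ONE row, `μ_u(j ↔ b) ≤ μ_u(a₁ ↔ b)` against the
core-loneliest relay `a₁`.  `…KNGoodGCThreeRow.lean` records that (`KNGoodGC3Adj.gc_threeRelays_row`); this file removes the pendant restriction:

* `KNGoodGC3Adj.gc_threeRelays_adj` — **GC₃ for children joined by a pair of ANY weight `t = u s(x,y)`.**  With `u₀ = u[xy ↦ 0]`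
  (two pendant stars) and `u₁ = u[xy ↦ 1]` (the glued observer), `μ_u = (1−t)μ_{u₀} + tμ_{u₁}` on every event (one-bond decomposition,
  `TieLocus.real_oneBond`), so the `u`-row `j ≤ a₁` forces `j ≤_{u₀} a₁` — then `gc_threeRelays_row` applies to `u₀`,
  whose glued graph is the same `u₁` — or `j ≤_{u₁} a₁`, and then the functional at `j` dominates the functional at `a₁`, which is
  the bottom case of `gc_threeRelays_row` (Kozma–Nitzan's Theorem 4, termwise).
* `KNGoodGC3Adj.knGood_twoChildren_threeRelays` — COROLLARY: `o ∉ A` with relay hairs and two children `x, y` whose other pairs go to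
  the three relays and to EACH OTHER, over ANY core: `KNGood w A hA o b`.  (Series socket `KNGoodSeries.knGood_series_of_gluing`; the
  children are good in `G − o` by Kozma–Nitzan's Theorem 5 — `x` has the single one-layer child `y` there — and `knGood_of_deleteHairs`.)
  Since every pair among `{o, x, y}` and every hair from `{o, x, y}` into `A` is allowed, this is: **every quadruple `(G, A, o, b)` with
  `|A| = 3` whose observer side `{o, x, y}` has at most three vertices (no positive pair from it to anything but `A`) is good** —
  Theorem 4 (one vertex), Theorem 5 (paths) and GC₃ (two pendant stars) being the sub-cases.
[cite: KozmaNitzan2024, Thms. 4–5 (pp. 12–14), Lemma 5 (p. 13), §3.2 Definition (p. 12); VandenbergHaggstromKahn2005, Thm. 1.5 (p. 7)]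
-/

noncomputable section

namespace Summit.CriticalPhenomena.PercolationContinuityZ3.Theorems

open MeasureTheory Set Literature.Probability.LatticeModels Literature.Probability.Percolation
open scoped Classical BigOperators

variable {n : ℕ}

namespace KNGoodGC3Adj

open ChampionStability KNGoodAux KNGoodHair KNGoodSeries KNGoodPortFree KNGoodTwoTwo KNGoodGC3

/-- **GC₃ with adjacent children.**  `x, y ∉ A = {a₁,a₂,a₃}` carry hairs into `A` and a pair `s(x,y)` of ARBITRARY weight (nothing else);
relays labelled by reliability in the core `K` (`x, y` killed); `j ∈ A` the loneliest relay of `u`.  Then the goodness functional of the glued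
observer `u[xy ↦ 1]` at the witness `j` is non-negative — hypothesis `hGC` of `KNGoodSeries.knGood_series_of_gluing`.
[cite: KozmaNitzan2024, Thms. 4–5 (pp. 12–14), Lemma 5 (p. 13); VandenbergHaggstromKahn2005, Thm. 1.5 (p. 7)] -/
theorem gc_threeRelays_adj (u : Sym2 (Fin n) → unitInterval) (A : Finset (Fin n)) (hA : A.Nonempty)
    (x y b a₁ a₂ a₃ j : Fin n) (hAeq : A = {a₁, a₂, a₃}) (h12 : a₁ ≠ a₂) (h13 : a₁ ≠ a₃) (h23 : a₂ ≠ a₃)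
    (hx : x ∉ A) (hy : y ∉ A) (hxy : x ≠ y) (hbx : b ≠ x) (hby : b ≠ y) (hjA : j ∈ A)
    (hxN : ∀ z : Fin n, z ∉ A → z ≠ y → u s(x, z) = 0) (hyN : ∀ z : Fin n, z ∉ A → z ≠ x → u s(y, z) = 0)
    (K : Sym2 (Fin n) → unitInterval) (hK : K = fun e => if x ∈ e then 0 else if y ∈ e then 0 else u e)
    (hs12 : (prodBernoulli K).real (openConn a₁ b) ≤ (prodBernoulli K).real (openConn a₂ b))
    (hs23 : (prodBernoulli K).real (openConn a₂ b) ≤ (prodBernoulli K).real (openConn a₃ b))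
    (hmin : ∀ a' ∈ A, (prodBernoulli u).real (openConn j b) ≤ (prodBernoulli u).real (openConn a' b)) :
    (prodBernoulli (Function.update u s(x, y) 1)).real (openConn j b) ≤
      (prodBernoulli (Function.update u s(x, y) 1)).real (openConn x b) +
        ∑ W ∈ nullSets A, (prodBernoulli (Function.update u s(x, y) 1)).real (clusterIs x W) *
          A.inf' hA (fun a' => (prodBernoulli (Function.update u s(x, y) 1)).real (openConnIn ((↑W : Set (Fin n))ᶜ) a' b)) := by
  have ha₁ : a₁ ∈ A := by rw [hAeq]; simp
  set e : Sym2 (Fin n) := s(x, y) with he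
  set u₀ : Sym2 (Fin n) → unitInterval := Function.update u e 0 with hu₀
  set u₁ : Sym2 (Fin n) → unitInterval := Function.update u e 1 with hu₁
  have h01 : Function.update u₀ e 1 = u₁ := by rw [hu₀, Function.update_idem]
  -- `u₀` has two pendant stars and the same core `K`
  have hxN0 : ∀ z : Fin n, z ∉ A → u₀ s(x, z) = 0 := by
    intro z hzA
    by_cases hzy : z = y
    · rw [hzy, hu₀, he, Function.update_self]
    · have hne : s(x, z) ≠ e := by
        rw [he]; intro h; exact hzy ((Sym2.congr_right).1 h)
      rw [hu₀, Function.update_of_ne hne]; exact hxN z hzA hzy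
  have hyN0 : ∀ z : Fin n, z ∉ A → u₀ s(y, z) = 0 := by
    intro z hzA
    by_cases hzx : z = x
    · rw [hzx, hu₀, he, Sym2.eq_swap, Function.update_self]
    · have hne : s(y, z) ≠ e := by
        rw [he]; intro h
        rcases Sym2.eq_iff.1 h with ⟨h1, _⟩ | ⟨_, h2⟩
        · exact hxy h1.symm
        · exact hzx h2
      rw [hu₀, Function.update_of_ne hne]; exact hyN z hzA hzx
  have hK0 : K = fun f => if x ∈ f then 0 else if y ∈ f then 0 else u₀ f := by
    rw [hK]; funext f
    by_cases hxf : x ∈ f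
    · simp only [hxf, if_true]
    · simp only [hxf, if_false]
      by_cases hyf : y ∈ f
      · simp only [hyf, if_true]
      · simp only [hyf, if_false]
        have hne : f ≠ e := by rw [he]; intro h; exact hxf (h ▸ Sym2.mem_mk_left x y)
        rw [hu₀, Function.update_of_ne hne]
  -- one-bond decomposition of the row `j ≤ a₁`
  set t : ℝ := (u e : ℝ) with ht
  have ht0 : 0 ≤ t := (u e).2.1
  have ht1 : t ≤ 1 := (u e).2.2
  have hmj := TieLocus.real_oneBond u e (openConn j b)
  have hma := TieLocus.real_oneBond u e (openConn a₁ b)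
  have hrowu := hmin a₁ ha₁
  by_cases hrow : (prodBernoulli u₀).real (openConn j b) ≤ (prodBernoulli u₀).real (openConn a₁ b)
  · -- the row holds between the two pendant stars: GC₃ verbatim
    have h := gc_threeRelays_row u₀ A hA x y b a₁ a₂ a₃ j hAeq h12 h13 h23 hx hy hxy hbx hby hjA hxN0 hyN0 K hK0 hs12 hs23 hrow
    rw [h01] at h; exact h
  · -- otherwise the row holds in the glued graph, where `j` dominates the core-loneliest relay `a₁`
    push Not at hrow
    have key : t * ((prodBernoulli u₁).real (openConn j b) - (prodBernoulli u₁).real (openConn a₁ b)) ≤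
        (1 - t) * ((prodBernoulli u₀).real (openConn a₁ b) - (prodBernoulli u₀).real (openConn j b)) := by
      rw [← hu₀, ← hu₁] at hmj hma
      linarith
    have hneg : (1 - t) * ((prodBernoulli u₀).real (openConn a₁ b) - (prodBernoulli u₀).real (openConn j b)) ≤ 0 :=
      mul_nonpos_of_nonneg_of_nonpos (by linarith) (by linarith)
    have htpos : 0 < t := by
      by_contra h0
      have ht00 : t = 0 := le_antisymm (not_lt.1 h0) ht0
      have : (prodBernoulli u).real (openConn j b) = (prodBernoulli u₀).real (openConn j b) := by
        rw [hmj, ← hu₀, ← ht, ht00]; ring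
      have this' : (prodBernoulli u).real (openConn a₁ b) = (prodBernoulli u₀).real (openConn a₁ b) := by
        rw [hma, ← hu₀, ← ht, ht00]; ring
      linarith
    have hrow1 : (prodBernoulli u₁).real (openConn j b) ≤ (prodBernoulli u₁).real (openConn a₁ b) := by
      by_contra hc
      push Not at hc
      have : 0 < t * ((prodBernoulli u₁).real (openConn j b) - (prodBernoulli u₁).real (openConn a₁ b)) :=
        mul_pos htpos (by linarith)
      linarith
    have hbot := gc_threeRelays_row u₀ A hA x y b a₁ a₂ a₃ a₁ hAeq h12 h13 h23 hx hy hxy hbx hby ha₁ hxN0 hyN0 K hK0 hs12 hs23 le_rfl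
    rw [h01] at hbot
    exact hrow1.trans hbot

open KNGoodSeriesEasy RelayNbhd in
/-- **Every separated quadruple with three relays and at most three vertices on the observer side is good.**  `o, x, y ∉ A = {a₁,a₂,a₃}`
distinct; the pairs at `o` go to `A ∪ {x, y}`, the pairs at `x` to `A ∪ {o, y}`, the pairs at `y` to `A ∪ {o, x}` (all weights arbitrary,
the core arbitrary); `b ∉ {o, x, y}`.  Then `KNGood w A hA o b`.
[cite: KozmaNitzan2024, Thms. 4–5 (pp. 12–14), Lemma 5 (p. 13), §3.2 Definition (p. 12); VandenbergHaggstromKahn2005, Thm. 1.5 (p. 7)] -/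
theorem knGood_twoChildren_threeRelays (w : Sym2 (Fin n) → unitInterval) (A : Finset (Fin n)) (hA : A.Nonempty)
    (o x y b a₁ a₂ a₃ : Fin n) (hAeq : A = {a₁, a₂, a₃}) (h12 : a₁ ≠ a₂) (h13 : a₁ ≠ a₃) (h23 : a₂ ≠ a₃)
    (ho : o ∉ A) (hx : x ∉ A) (hy : y ∉ A) (hxo : x ≠ o) (hyo : y ≠ o) (hxy : x ≠ y)
    (hbo : b ≠ o) (hbx : b ≠ x) (hby : b ≠ y)
    (hoN : ∀ v : Fin n, v ≠ o → v ∉ A → v ≠ x → v ≠ y → w s(o, v) = 0)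
    (hxN : ∀ z : Fin n, z ∉ A → z ≠ o → z ≠ y → w s(x, z) = 0)
    (hyN : ∀ z : Fin n, z ∉ A → z ≠ o → z ≠ x → w s(y, z) = 0) :
    KNGood w A hA o b := by
  haveI : ∀ v : Sym2 (Fin n) → unitInterval, IsProbabilityMeasure (prodBernoulli v) := fun v => inferInstance
  -- delete the relay hairs at `o`
  set w' : Sym2 (Fin n) → unitInterval := fun e => if ∃ q ∈ A, e = s(o, q) then 0 else w e with hw'
  refine knGood_of_deleteHairs w A hA o b ho ?_
  rw [← hw']
  have hpin : pinW w' {e : Sym2 (Fin n) | o ∈ e ∧ ¬ e.IsDiag} ∅ = pinW w {e : Sym2 (Fin n) | o ∈ e ∧ ¬ e.IsDiag} ∅ := by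
    refine pinW_star_eq_of_eqOff w w' o fun e he => ?_
    rw [hw']; simp only
    rw [if_neg]
    rintro ⟨q, hq', rfl⟩
    exact he ⟨Sym2.mem_mk_left o q, fun hd => ho ((Sym2.mk_isDiag_iff.1 hd) ▸ hq')⟩
  set u := pinW w {e : Sym2 (Fin n) | o ∈ e ∧ ¬ e.IsDiag} ∅ with hu
  have huoff : ∀ c d : Fin n, c ≠ o → d ≠ o → u s(c, d) = w s(c, d) := by
    intro c d hc hd
    have hmem : s(c, d) ∉ {e : Sym2 (Fin n) | o ∈ e ∧ ¬ e.IsDiag} := by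
      rintro ⟨hoe, -⟩
      rcases Sym2.mem_iff.1 hoe with h | h
      · exact hc h.symm
      · exact hd h.symm
    rw [hu, pinW_apply_of_not_mem w ∅ hmem]
  have huo : ∀ v : Fin n, v ≠ o → u s(v, o) = 0 := by
    intro v hv; rw [Sym2.eq_swap, hu]; exact pinW_star_mk w hv
  have hxNu : ∀ z : Fin n, z ∉ A → z ≠ y → u s(x, z) = 0 := by
    intro z hzA hzy
    by_cases hzo : z = o
    · rw [hzo]; exact huo x hxo
    · rw [huoff x z hxo hzo]; exact hxN z hzA hzo hzy
  have hyNu : ∀ z : Fin n, z ∉ A → z ≠ x → u s(y, z) = 0 := by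
    intro z hzA hzx
    by_cases hzo : z = o
    · rw [hzo]; exact huo y hyo
    · rw [huoff y z hyo hzo]; exact hyN z hzA hzo hzx
  -- goodness of the two children in `G − o` (Kozma–Nitzan, Thm. 5: each has the other as its only one-layer child)
  have hgoodx : KNGood u A hA x b := by
    refine KozmaNitzan2024_thm5 u A hA x b y hx hbx (fun h => hxy h.symm) (fun v hvx hvA hvy => hxNu v hvA hvy) ?_
    refine KozmaNitzan2024_thm4_good _ A hA y b hy fun z hzy hzA => ?_
    by_cases hzx : z = x
    · rw [hzx]
      exact restrW_apply_of_not_mem u (fun hm => (Set.mem_compl_singleton_iff.1 (mk_mem_wireSet_iff.1 hm).2.1) rfl)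
    · rw [restrW_apply_of_mem u (mk_mem_wireSet_iff.2 ⟨Set.mem_compl_singleton_iff.2 (fun h => hxy h.symm),
        Set.mem_compl_singleton_iff.2 hzx, fun h => hzy h.symm⟩)]
      exact hyNu z hzA hzx
  have hgoody : KNGood u A hA y b := by
    refine KozmaNitzan2024_thm5 u A hA y b x hy hby hxy (fun v hvy hvA hvx => hyNu v hvA hvx) ?_
    refine KozmaNitzan2024_thm4_good _ A hA x b hx fun z hzx hzA => ?_
    by_cases hzy : z = y
    · rw [hzy]
      exact restrW_apply_of_not_mem u (fun hm => (Set.mem_compl_singleton_iff.1 (mk_mem_wireSet_iff.1 hm).2.1) rfl)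
    · rw [restrW_apply_of_mem u (mk_mem_wireSet_iff.2 ⟨Set.mem_compl_singleton_iff.2 hxy,
        Set.mem_compl_singleton_iff.2 hzy, fun h => hzx h.symm⟩)]
      exact hxNu z hzA hzy
  -- the witness: the loneliest relay of `G − o`
  obtain ⟨a₀, ha₀, hmin⟩ := A.exists_min_image (fun a => (prodBernoulli u).real (openConn a b)) hA
  -- sort the relays by their reliability in the core
  set K : Sym2 (Fin n) → unitInterval := fun e => if x ∈ e then 0 else if y ∈ e then 0 else u e with hK
  obtain ⟨b₁, b₂, b₃, hP, hb12, hb13, hb23, hs12, hs23⟩ :=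
    exists_sorted_three (fun a => (prodBernoulli K).real (openConn a b)) a₁ a₂ a₃ h12 h13 h23
  have hAeq' : A = {b₁, b₂, b₃} := hAeq.trans hP
  have hGC := gc_threeRelays_adj u A hA x y b b₁ b₂ b₃ a₀ hAeq' hb12 hb13 hb23 hx hy hxy hbx hby ha₀ hxNu hyNu K hK hs12 hs23 hmin
  -- the series step
  exact knGood_series_of_gluing w' A hA o x y a₀ b ho hxo hyo hxy ha₀ hbo
    (fun v hvo hvx hvy => by
      rw [hw']; simp only
      by_cases hvA : v ∈ A
      · rw [if_pos ⟨v, hvA, rfl⟩]; rfl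
      · rw [if_neg]
        · exact congrArg Subtype.val (hoN v hvo hvA hvx hvy)
        · rintro ⟨q, hq', hvq⟩
          exact hvA ((Sym2.congr_right.1 hvq) ▸ hq'))
    (by rw [hpin]; exact hmin) (by rw [hpin]; exact hgoodx) (by rw [hpin]; exact hgoody) (by rw [hpin]; linarith [hGC])

end KNGoodGC3Adj

end Summit.CriticalPhenomena.PercolationContinuityZ3.Theorems
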